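import Literature.Analysis.FluidPDE.ParabolicHeatPotentials
import Mathlib.Analysis.SpecialFunctions.SmoothTransition
import Mathlib.Analysis.SpecialFunctions.Pow.Deriv
import Mathlib.Analysis.SpecialFunctions.Pow.Asymptotics
import HarnessLib

/-!
# The forward space–time heat kernel is smooth away from the spatial origin

Analysis/FluidPDE support file (everything proved) in the decomposition of the named fact
`Literature.Analysis.FluidPDE.LemarieRieusset2016.lemma13_6_duhamel` (`CKNMorreyHolder.lean`:
Lemarié-Rieusset 2016, §13.9 Step 3 and the proof of Lemma 13.6, pp. 474–478). The terms of the
Duhamel representation whose data are supported in the annulus where the cut-off varies are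
potentials `∫ W₊(z - w) F(w) dw` evaluated at points `z` spatially separated from the data; there
the **zero-extended** heat kernel `W₊(τ, y) = 1_{τ>0} G_{ντ}(y)` (`heatKernelFwd`,
`ParabolicHeatPotentials.lean`) is a smooth function of `(τ, y)` — across `τ = 0` included — and
the potentials are smooth. This file proves the kernel statement:

* `rpowInvGlue r x = (x⁻¹)^r · expNegInvGlue x` — the flat function `x^{-r} e^{-1/x}` (`x > 0`),
  `0` (`x ≤ 0`), for a **real** exponent `r`, and `contDiff_polynomial_rpowInvGlue`:
  `x ↦ p(x⁻¹) · rpowInvGlue r x` is `C^∞` for every polynomial `p` (Mathlib's argument for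
  `expNegInvGlue` — `SmoothTransition.lean`, `contDiff_polynomial_eval_inv_mul` — run with the
  extra factor `(x⁻¹)^r`: the family is stable under differentiation,
  `(p(x⁻¹) x^{-r} e^{-1/x})' = q(x⁻¹) x^{-r} e^{-1/x}`, `q = X²(p - p') - rXp`, and tends to `0`
  at `0`);
* `heatKernelFwd_eq_rpowInvGlue` — for `y ≠ 0`,
  `W₊(τ, y) = (4πν a)^{-d/2} · rpowInvGlue (d/2) (τ/a)`, `a = ‖y‖²/(4ν)`, `d = dim E`;
* `contDiffOn_heatKernelFwd` — **`W₊` is `C^∞` on `ℝ × (E ∖ {0})`**.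

## Mathlib / tree search

Mathlib (all used): `expNegInvGlue` and its smoothness mechanism
(`Real.tendsto_…`, `hasDerivAt_iff_tendsto_slope`, `contDiff_succ_iff_deriv`,
`contDiff_all_iff_nat`), `tendsto_rpow_mul_exp_neg_mul_atTop_nhds_zero`, `tendsto_inv_nhdsGT_zero`,
`Real.hasDerivAt_rpow_const`, `Real.contDiffAt_rpow_const_of_ne`, `contDiff_norm_sq`. Tree:
`heatKernelFwd`, `UnboundedOperators.heatKernel`. Nothing on smoothness of the zero-extended heat
kernel across `τ = 0` (`lean search 'heatKernelFwd|heatDuhamelKernel' + ContDiff`: none; the tree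
has joint smoothness on `τ > 0` only, `contDiffOn_uncurry_heatKernel`).

## References

* L. C. Evans, *Partial Differential Equations*, 2nd ed. (AMS 2010), §2.3.1 (the fundamental
  solution is smooth off the origin of space–time).
* P. G. Lemarié-Rieusset, *The Navier–Stokes Problem in the 21st Century*, CRC Press (2016),
  Prop. 13.4 proof p. 465 (size of `W₊` off the diagonal). [LemarieRieusset2016]
-/

noncomputable section

open Polynomial Filter Topology Real Set MeasureTheory

namespace Literature.Analysis.FluidPDE

/-! ### The flat functions `x^{-r} e^{-1/x}` -/

section Glue

/-- **The flat function `x ↦ x^{-r} e^{-1/x}`** (`x > 0`), extended by `0` for `x ≤ 0`, for a real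
exponent `r`: `rpowInvGlue r x = (x⁻¹)^r · expNegInvGlue x`. [folklore] -/
def rpowInvGlue (r : ℝ) (x : ℝ) : ℝ :=
  (x⁻¹) ^ r * expNegInvGlue x

variable {r : ℝ}

/-- `rpowInvGlue r` vanishes on `(-∞, 0]`. [folklore] -/
theorem rpowInvGlue_of_nonpos {x : ℝ} (hx : x ≤ 0) : rpowInvGlue r x = 0 := by
  rw [rpowInvGlue, expNegInvGlue.zero_of_nonpos hx, mul_zero]

/-- `rpowInvGlue r 0 = 0`. [folklore] -/
@[simp]
theorem rpowInvGlue_zero : rpowInvGlue r 0 = 0 :=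
  rpowInvGlue_of_nonpos le_rfl

/-- On `(0, ∞)`: `rpowInvGlue r x = (x⁻¹)^r e^{-x⁻¹}`. [folklore] -/
theorem rpowInvGlue_of_pos {x : ℝ} (hx : 0 < x) : rpowInvGlue r x = (x⁻¹) ^ r * exp (-x⁻¹) := by
  simp [rpowInvGlue, expNegInvGlue, not_le.2 hx]

/-- `rpowInvGlue r` is nonnegative. [folklore] -/
theorem rpowInvGlue_nonneg (x : ℝ) : 0 ≤ rpowInvGlue r x := by
  by_cases hx : 0 < x
  · rw [rpowInvGlue_of_pos hx]
    exact mul_nonneg (Real.rpow_nonneg (inv_nonneg.2 hx.le) _) (exp_pos _).le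
  · rw [rpowInvGlue_of_nonpos (not_lt.1 hx)]

/-- At infinity, `p(y) yʳ e^{-y} → 0` for every polynomial `p` and real `r`. [folklore] -/
theorem tendsto_polynomial_mul_rpow_mul_exp_neg_atTop (p : ℝ[X]) (r : ℝ) :
    Tendsto (fun y : ℝ => p.eval y * (y ^ r * exp (-y))) atTop (𝓝 0) := by
  have key : ∀ i : ℕ, Tendsto (fun y : ℝ => y ^ i * (y ^ r * exp (-y))) atTop (𝓝 0) := by
    intro i
    have h := tendsto_rpow_mul_exp_neg_mul_atTop_nhds_zero ((i : ℝ) + r) 1 one_pos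
    refine h.congr' ?_
    filter_upwards [eventually_gt_atTop 0] with y hy
    rw [Real.rpow_add hy, Real.rpow_natCast, neg_mul, one_mul]
    ring
  have hsum : Tendsto (fun y : ℝ => ∑ i ∈ Finset.range (p.natDegree + 1),
      p.coeff i * (y ^ i * (y ^ r * exp (-y)))) atTop (𝓝 0) := by
    have h := tendsto_finsetSum (Finset.range (p.natDegree + 1))
      (fun i _ => (key i).const_mul (p.coeff i))
    simpa using h
  refine hsum.congr' (Eventually.of_forall fun y => ?_)
  show _ = p.eval y * (y ^ r * exp (-y))
  rw [Polynomial.eval_eq_sum_range, Finset.sum_mul]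
  refine Finset.sum_congr rfl fun i _ => ?_
  ring

/-- `p(x⁻¹) · rpowInvGlue r x → 0` as `x → 0`. [folklore] -/
theorem tendsto_polynomial_rpowInvGlue_zero (p : ℝ[X]) (r : ℝ) :
    Tendsto (fun x => p.eval x⁻¹ * rpowInvGlue r x) (𝓝 0) (𝓝 0) := by
  simp only [rpowInvGlue, expNegInvGlue, mul_ite, mul_zero]
  refine tendsto_const_nhds.if ?_
  simp only [not_le]
  have h : Tendsto (fun x : ℝ => p.eval x⁻¹ * (x⁻¹ ^ r * exp (-x⁻¹))) (𝓝[>] 0) (𝓝 0) :=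
    (tendsto_polynomial_mul_rpow_mul_exp_neg_atTop p r).comp tendsto_inv_nhdsGT_zero
  exact h

/-- **Stability under differentiation**: with `q = X²(p - p') - rXp`,
`(p(x⁻¹) · rpowInvGlue r x)' = q(x⁻¹) · rpowInvGlue r x` at every `x`. [folklore] -/
theorem hasDerivAt_polynomial_rpowInvGlue (p : ℝ[X]) (r x : ℝ) :
    HasDerivAt (fun x => p.eval x⁻¹ * rpowInvGlue r x)
      ((X ^ 2 * (p - derivative (R := ℝ) p) - C r * X * p).eval x⁻¹ * rpowInvGlue r x) x := by
  rcases lt_trichotomy x 0 with hx | rfl | hx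
  · rw [rpowInvGlue_of_nonpos hx.le, mul_zero]
    refine (hasDerivAt_const _ 0).congr_of_eventuallyEq ?_
    filter_upwards [gt_mem_nhds hx] with y hy
    rw [rpowInvGlue_of_nonpos hy.le, mul_zero]
  · rw [rpowInvGlue_zero, mul_zero, hasDerivAt_iff_tendsto_slope]
    refine ((tendsto_polynomial_rpowInvGlue_zero (p * X) r).mono_left inf_le_left).congr fun y => ?_
    simp only [slope_def_field, sub_zero, rpowInvGlue_zero, mul_zero, eval_mul, eval_X]
    ring
  · -- on `(0, ∞)` the function is `h ∘ inv`, `h(z) = p(z) zʳ e^{-z}`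
    set z : ℝ := x⁻¹ with hz_def
    have hz0 : 0 < z := inv_pos.2 hx
    have hh : HasDerivAt (fun z : ℝ => p.eval z * (z ^ r * exp (-z)))
        ((derivative (R := ℝ) p).eval z * (z ^ r * exp (-z)) +
          p.eval z * (r * z ^ (r - 1) * exp (-z) + z ^ r * (-exp (-z)))) z := by
      have h1 := p.hasDerivAt z
      have h2 : HasDerivAt (fun z : ℝ => z ^ r) (r * z ^ (r - 1)) z :=
        Real.hasDerivAt_rpow_const (Or.inl hz0.ne')
      have h3 : HasDerivAt (fun z : ℝ => exp (-z)) (-exp (-z)) z := by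
        simpa using (hasDerivAt_neg z).exp
      exact h1.mul (h2.mul h3)
    have hcomp := hh.comp x (hasDerivAt_inv hx.ne')
    have heq : (fun x => p.eval x⁻¹ * rpowInvGlue r x) =ᶠ[𝓝 x]
        (fun z : ℝ => p.eval z * (z ^ r * exp (-z))) ∘ fun y => y⁻¹ := by
      filter_upwards [lt_mem_nhds hx] with y hy
      simp only [Function.comp, rpowInvGlue_of_pos hy]
    refine (hcomp.congr_of_eventuallyEq heq).congr_deriv ?_
    -- the value of the derivative
    have hzr : z ^ (r - 1) = z ^ r * z⁻¹ := by
      rw [Real.rpow_sub_one hz0.ne', div_eq_mul_inv]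
    rw [rpowInvGlue_of_pos hx, ← hz_def]
    simp only [eval_sub, eval_mul, eval_pow, eval_X, eval_C, hzr]
    have hx2 : -(x ^ 2)⁻¹ = -z ^ 2 := by rw [hz_def, inv_pow]
    rw [hx2]
    field_simp
    ring

/-- `x ↦ p(x⁻¹) · rpowInvGlue r x` is differentiable. [folklore] -/
theorem differentiable_polynomial_rpowInvGlue (p : ℝ[X]) (r : ℝ) :
    Differentiable ℝ (fun x => p.eval x⁻¹ * rpowInvGlue r x) := fun x =>
  (hasDerivAt_polynomial_rpowInvGlue p r x).differentiableAt

/-- `x ↦ p(x⁻¹) · rpowInvGlue r x` is continuous. [folklore] -/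
theorem continuous_polynomial_rpowInvGlue (p : ℝ[X]) (r : ℝ) :
    Continuous (fun x => p.eval x⁻¹ * rpowInvGlue r x) :=
  (differentiable_polynomial_rpowInvGlue p r).continuous

/-- **`x ↦ p(x⁻¹) · rpowInvGlue r x` is `C^∞`** for every polynomial `p` and real `r` (induction on
the order through the stability `q = X²(p - p') - rXp`). [folklore] -/
theorem contDiff_polynomial_rpowInvGlue {n : ℕ∞} (p : ℝ[X]) (r : ℝ) :
    ContDiff ℝ n (fun x => p.eval x⁻¹ * rpowInvGlue r x) := by
  apply contDiff_all_iff_nat.2 (fun m => ?_) n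
  induction m generalizing p with
  | zero => exact contDiff_zero.2 <| continuous_polynomial_rpowInvGlue _ r
  | succ m ihm =>
    rw [show ((m + 1 : ℕ) : WithTop ℕ∞) = m + 1 from rfl]
    refine contDiff_succ_iff_deriv.2 ⟨differentiable_polynomial_rpowInvGlue _ r, by simp, ?_⟩
    convert! ihm (X ^ 2 * (p - derivative (R := ℝ) p) - C r * X * p) using 2
    exact (hasDerivAt_polynomial_rpowInvGlue p r _).deriv

/-- **The flat function `rpowInvGlue r` is `C^∞`.** [folklore] -/
theorem contDiff_rpowInvGlue {n : ℕ∞} (r : ℝ) : ContDiff ℝ n (rpowInvGlue r) := by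
  simpa using contDiff_polynomial_rpowInvGlue 1 r

end Glue

/-! ### The zero-extended heat kernel off the spatial origin -/

section HeatKernel

variable {E : Type*} [NormedAddCommGroup E] [InnerProductSpace ℝ E]

/-- Algebra of the Gaussian: for `a, θ, c > 0` and real `r`,
`(c a)^{-r} (a/θ)^{r} = (c θ)^{-r}`. [folklore] -/
theorem rpow_neg_mul_div_rpow {c a θ r : ℝ} (hc : 0 < c) (ha : 0 < a) (hθ : 0 < θ) :
    (c * a) ^ (-r) * (a / θ) ^ r = (c * θ) ^ (-r) := by
  rw [Real.rpow_neg (by positivity), Real.rpow_neg (by positivity), ← Real.inv_rpow (by positivity),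
    ← Real.inv_rpow (by positivity), ← Real.mul_rpow (by positivity) (by positivity)]
  congr 1
  field_simp

/-- **The zero-extended heat kernel as a flat function of the rescaled time**: for `y ≠ 0`,
`ν > 0` and every `τ`,
`W₊(τ, y) = (4πν a)^{-d/2} · rpowInvGlue (d/2) (τ/a)`, `a = ‖y‖²/(4ν)`, `d = dim E`. [folklore] -/
theorem heatKernelFwd_eq_rpowInvGlue {ν : ℝ} (hν : 0 < ν) (τ : ℝ) {y : E} (hy : y ≠ 0) :
    heatKernelFwd ν (τ, y) =
      (4 * π * ν * (‖y‖ ^ 2 / (4 * ν))) ^ (-(Module.finrank ℝ E : ℝ) / 2) *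
        rpowInvGlue ((Module.finrank ℝ E : ℝ) / 2) (τ / (‖y‖ ^ 2 / (4 * ν))) := by
  set a : ℝ := ‖y‖ ^ 2 / (4 * ν) with ha
  have ha0 : 0 < a := by
    have : 0 < ‖y‖ := norm_pos_iff.2 hy
    positivity
  set d : ℝ := (Module.finrank ℝ E : ℝ) with hd
  by_cases hτ : 0 < τ
  · have hτa : 0 < τ / a := div_pos hτ ha0
    rw [heatKernelFwd_of_pos ν (by exact hτ), rpowInvGlue_of_pos hτa, UnboundedOperators.heatKernel]
    dsimp only
    rw [inv_div, show -d / 2 = -(d / 2) by ring,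
      show (4 * π * ν * a) ^ (-(d / 2)) * ((a / τ) ^ (d / 2) * exp (-(a / τ))) =
        ((4 * π * ν * a) ^ (-(d / 2)) * (a / τ) ^ (d / 2)) * exp (-(a / τ)) by ring,
      rpow_neg_mul_div_rpow (c := 4 * π * ν) (r := d / 2) (by positivity) ha0 hτ]
    congr 1
    · congr 1; ring
    · congr 1
      rw [ha]
      field_simp
  · have hτ' : τ ≤ 0 := not_lt.1 hτ
    rw [heatKernelFwd_of_nonpos ν (by exact hτ'), rpowInvGlue_of_nonpos, mul_zero]
    exact div_nonpos_of_nonpos_of_nonneg hτ' ha0.le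

/-- **The zero-extended heat kernel `W₊(τ, y) = 1_{τ>0} G_{ντ}(y)` is `C^∞` on `ℝ × (E ∖ {0})`**
(`ν > 0`): through `heatKernelFwd_eq_rpowInvGlue` it is a composite of smooth maps there. [folklore] -/
theorem contDiffOn_heatKernelFwd {ν : ℝ} (hν : 0 < ν) {n : ℕ∞} :
    ContDiffOn ℝ n (heatKernelFwd (E := E) ν) {p : ℝ × E | p.2 ≠ 0} := by
  set d : ℝ := (Module.finrank ℝ E : ℝ) with hd
  -- the smooth model
  set Φ : ℝ × E → ℝ := fun p =>
    (4 * π * ν * (‖p.2‖ ^ 2 / (4 * ν))) ^ (-d / 2) * rpowInvGlue (d / 2) (p.1 / (‖p.2‖ ^ 2 / (4 * ν)))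
    with hΦ
  have ha : ContDiff ℝ n fun p : ℝ × E => ‖p.2‖ ^ 2 / (4 * ν) :=
    ((contDiff_norm_sq ℝ).comp contDiff_snd).div_const _
  have ha0 : ∀ p : ℝ × E, p ∈ {p : ℝ × E | p.2 ≠ 0} → ‖p.2‖ ^ 2 / (4 * ν) ≠ 0 := by
    intro p hp
    have : 0 < ‖p.2‖ := norm_pos_iff.2 hp
    positivity
  have hΦs : ContDiffOn ℝ n Φ {p : ℝ × E | p.2 ≠ 0} := by
    refine ContDiffOn.mul ?_ ?_
    · intro p hp
      have h1 : ContDiffAt ℝ n (fun p : ℝ × E => 4 * π * ν * (‖p.2‖ ^ 2 / (4 * ν))) p :=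
        (contDiff_const.mul ha).contDiffAt
      have hne : 4 * π * ν * (‖p.2‖ ^ 2 / (4 * ν)) ≠ 0 := by
        have := ha0 p hp
        positivity
      exact ((Real.contDiffAt_rpow_const_of_ne (p := -d / 2) hne).comp p h1).contDiffWithinAt
    · have h2 : ContDiffOn ℝ n (fun p : ℝ × E => p.1 / (‖p.2‖ ^ 2 / (4 * ν))) {p : ℝ × E | p.2 ≠ 0} :=
        contDiffOn_fst.div ha.contDiffOn ha0
      exact (contDiff_rpowInvGlue (d / 2)).comp_contDiffOn h2
  refine hΦs.congr fun p hp => ?_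
  rw [show p = (p.1, p.2) from rfl, heatKernelFwd_eq_rpowInvGlue hν p.1 hp]

/-- The same on the smaller open sets `ℝ × {‖y‖ > ε}`, `ε ≥ 0`. [folklore] -/
theorem contDiffOn_heatKernelFwd_of_norm {ν : ℝ} (hν : 0 < ν) {n : ℕ∞} {ε : ℝ} (hε : 0 ≤ ε) :
    ContDiffOn ℝ n (heatKernelFwd (E := E) ν) {p : ℝ × E | ε < ‖p.2‖} :=
  (contDiffOn_heatKernelFwd hν).mono fun p hp => by
    have : 0 < ‖p.2‖ := hε.trans_lt hp
    exact norm_pos_iff.1 this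

omit [InnerProductSpace ℝ E] in
/-- The sets `ℝ × {‖y‖ > ε}` are open. [folklore] -/
theorem isOpen_setOf_lt_norm_snd (ε : ℝ) : IsOpen {p : ℝ × E | ε < ‖p.2‖} :=
  isOpen_lt continuous_const (continuous_norm.comp continuous_snd)

end HeatKernel

end Literature.Analysis.FluidPDE
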